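import Summits.QuantumFields.YangMills.Theorems.BalabanUVNodesN15CurvedTransporterLetters
import HarnessLib

/-!
# Route «BalabanUVNodes» (cluster K4 «SpineRates»), Track-A DAG node N15 = NE2, BACKGROUND LAYER — THE η-FIT OF THE COVARIANT-GRADIENT FIELD
# `g = η⁻²(S_μ − R₋ᵀS₋R₋)` AT A CURVED BASE POINT FROM GENERATOR-LEVEL DATA (file 4's last displayed transporter-level fit `o_g`), and the
# (3.52) DICTIONARY: `η⁻²(S_μ − R₋ᵀS₋R₋)` IS the generator's covariant lattice derivative `∇Z + [W₋, Z₋]` up to `O(η)`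

Cell `pub-ymgap`, seat `pub-ymgap-dag-n15-w3` (WIDTH SEAT 3∕3 on node N15, director-ym №197 ∕ HUMAN RULING D-0149; plan `W-SEAT-START-LIST.md` §n15 item 3
«`NE2PlusOperator` for the background layer at GENERAL small-field U» — sixth piece; seat HANDOFF «what remains (d) ∕ trigger (t2)»).
`bears_on: R4∕N15 · K3⁷ SpineGivenEndpointR13SepCoPH (stmt-QuantumFields-20544)`.  Filed `--kind proof --supports stmt-QuantumFields-20544 --as helper` —
COUNT-NEUTRAL.  Imports BY NAME this seat's file 5 `…N15CurvedTransporterLetters` (p589511: `expTrField`, `expTrField_apply`, `coordMat_mul`, `abs_coordMat_sub_entry_le`,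
`Phi0_neg_mul_Phi0`, `conj_defect_identity`; through it file 1 `covShiftDefect` and the lineage's n15-b 13a∕13b∕18 `Phi0`, `Phi1`, `Phi2`, `Phi1_lipschitz`,
`Phi1_consistency`, `Phi2_lipschitz`, `Phi0_consistency`, `fit_Phi1`, dag-n15-c FILE 28 `Phi1_eq_smul`, `Phi1_eq_add_smul_Phi2`, `coordMat_smul`); nothing in the tree is modified.

WHY.  File 4 (p587618) `hasMaj_idef_curvDressed` — NE2⁺ (entries 0∕1, block form) PROPAGATES from `U` to `U′U` — displays four transporter-level η-FITS of the
perturbation: `o_a`, `o_t`, `o_R` (inhabited by file 5 from generator-level data of the (3.37) shape, `S = coordMat e (e^{ηZ})`, `R = coordMat e (e^{ηW})`) and `o_g`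
(hypothesis `hfg`), the fit of the COVARIANT-GRADIENT FIELD `g_μ(x) = η⁻²·(S_μ(x) − R₋ᵀS_μ(x − e_μ)R₋)` between two spacings — a SECOND-ORDER Taylor statement about
conjugated exponentials, left displayed.  THIS FILE inhabits it.  [Balaban1985BackgroundPropagators] (3.52) p. 400: *«(V′₁(A)λ)(x) = Σ_{b∈st(x)} i[A′(b), (D^η_U λ)(b)]
+ i[(D^{η*}_U A′)(x), λ(x)] + Σ_{b∈st(x)} F′_{1,k}(i ad_{A′(b)}) λ(b₊)»*: the zeroth-order coefficient is the COVARIANT DIVERGENCE of the generator plus the `F′_{1,k}`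
remainder; §2 shows that the lineage's transporter-form summand `η⁻²(S_μ − R₋ᵀS₋R₋)` (file 1's `covShiftDefect` after the cancellation `curvCoefC_eq_cancel`) IS, in
generator coordinates, `∇Z + [W₋, Z₋] + O(η)` — the lattice derivative of the generator made covariant by the background generator (ad of the print's `D^η_U A′`,
since `[ad B, ad A′] = ad [B, A′]`), the `O(η)` being `Φ₂`∕`Φ₁Φ₁` terms with explicit letters.
* §1 letters in a (complete) real normed algebra: `Phi1_at_zero`, ★ `Phi0_eq_one_add_smul_Phi1` (`e^{ηZ} = 1 + ηΦ₁(η,Z)`, all `η`), `norm_Phi1_le_of_le` (`≤ e r`),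
  `norm_Phi1_sub_self_le` (`≤ e r² s`), `norm_Phi1_neg_add_self_le`, `norm_Phi0_sub_one_le` (`≤ e r_B s`), `norm_Phi0_sub_Phi0_le_two` (two spacings, `≤ 2e r_B η`); Leibniz
  in a normed ring: `prod3_sub_prod3_eq`, `norm_prod3_sub_prod3_le_of_bounds`, `norm_prod3_add_mul_le_of_bounds`, `norm_prod2_sub_prod2_le_of_bounds`; ★ `Phi0_sub_conj_eq` —
  THE EXACT η²-STRUCTURE: `e^{ηZ₊} − e^{−ηW}e^{ηZ₋}e^{ηW} = η(Z₊ − Z₋) + η²(Φ₂Z₊ − Φ₂Z₋) − η²(Φ₁(−W)Φ₁(Z₋)e^{ηW} + Φ₁(Z₋)Φ₁(W))`;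
* §2 def `covGradGen η τ Z W` (generator form of `g`), `norm_Phi0_clm_le` (`‖e^{sW}‖ ≤ 1 + e`), ★★ `smul_covShiftDefect_exp_eq_coordMat` (`(η⁻¹η⁻¹)•covShiftDefect τ
  (expTrField e η W) (expTrField e η Z) μ x = coordMat e (covGradGen η τ Z W μ x)` EXACTLY for `η ≠ 0` under file 5's orthogonal-model identification `hRt`), def
  `covDerivRem`, ★★ `norm_covGradGen_sub_covDeriv_le` (THE (3.52) DICTIONARY: `‖covGradGen − (η⁻¹(Z₊ − Z₋) + (W₋Z₋ − Z₋W₋))‖ ≤ η·covDerivRem r r_B g`);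
* §3 def `gradFitLetter` (+ `_nonneg`), ★★ `fit_covGradGen` (two-spacing fit of `covGradGen` from the lattice-DERIVATIVE fit `o_D`, the TRANSLATED generator fits `o_t`, `o_W`,
  the gradient letters `ηg`, sizes, regimes — RATE ONE: affine in `(o_D, o_t, o_W, η)`), ★★★ `fit_covShiftDefect_exp` — file 4's `hfg` INHABITED at `S = expTrField e η Z`,
  `R = expTrField e η W` (both grids): `|((η′⁻¹η′⁻¹)•covShiftDefect τ′ R′ S′ μ x′ − (η⁻¹η⁻¹)•covShiftDefect τ R S μ (πx′))_{ij}| ≤ κ_e·gradFitLetter r r_B g o_D o_t o_W η`.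
After this file ALL FOUR transporter-level fits of file 4 are inhabited from generator-level letters and fits of the (3.37) shape.

HONEST FRAMING ∕ LIMITS.  Taylor∕Leibniz bookkeeping over the lineage's `exp`∕coordinate species ([B9] (3.37) p. 396, (3.52) p. 400 = SHAPES ∕ MECHANISM; nothing
of [B9] asserted); the ORTHOGONALITY MODEL of files 1–4 (`hRt`: the transpose IS the inverse transport; true for an `ℓ²`-orthonormal `e` and skew generators,
not derived for a general `e`) stays a displayed hypothesis; the generator-level fits `o_D, o_t, o_W` (NE3∕(C3)-type letters of the perturbation's and the
background's generators between two grids) are displayed; crude constants.  The η-defects∕majorants of `G(U)`, `D^±_RG(U)` at the curved `U` and the [B6]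
gluing of cube-wise gauges stay displayed (files 3–4).  NE2⁺ NOT PRINTED, NOT proved; N15 NOT discharged; counts of record UNMOVED (typed 28∕28 · discharged
5∕27); one finite 𝕋⁴ at fixed ε — NOT infinite volume, NOT OS on ℝ⁴, NOT a mass gap, NOT Clay; R4 closes the conditional finite-𝕋⁴ rung `BalabanLadder.UV` only.
Restate-immune (no Theses import).
-/

set_option autoImplicit false

noncomputable section
open scoped BigOperators Matrix
open Finset NormedSpace

namespace Summit.QuantumFields.YangMills.BalabanUVNodes.N15.CurvedSpecies

open Summit.QuantumFields.YangMills.BalabanUVNodes.N15.MatrixSpecies (Phi0 Phi1 Phi2 Phi0_zero Phi1_zero Phi0_consistency Phi1_lipschitz Phi1_consistency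
  Phi2_lipschitz fit_Phi1 coordMat basisConst basisConst_nonneg coordMat_sub)
open Summit.QuantumFields.YangMills.BalabanUVNodes.N15.BackgroundLayer (coordMat_smul Phi1_eq_smul Phi1_eq_add_smul_Phi2)

/-! ## §1 Species letters and the exact η²-structure of the conjugated-exponential defect -/

section Leibniz

variable {𝔅 : Type} [NormedRing 𝔅]

/-- THREE-TERM LEIBNIZ in a ring: `A′B′C′ − ABC = (A′ − A)B′C′ + A(B′ − B)C′ + AB(C′ − C)`. [folklore] -/
theorem prod3_sub_prod3_eq (A A' B B' C C' : 𝔅) : A' * B' * C' - A * B * C = (A' - A) * B' * C' + A * (B' - B) * C' + A * B * (C' - C) := by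
  noncomm_ring

/-- THREE-TERM LEIBNIZ WITH LETTERS: `‖A‖ ≤ x`, `‖B‖, ‖B′‖ ≤ y`, `‖C′‖ ≤ z` and difference letters `dx, dy, dz` give
`‖A′B′C′ − ABC‖ ≤ dx·y·z + x·dy·z + x·y·dz`. [folklore] -/
theorem norm_prod3_sub_prod3_le_of_bounds {A A' B B' C C' : 𝔅} {x y z dx dy dz : ℝ} (hx : ‖A‖ ≤ x) (hy' : ‖B'‖ ≤ y) (hy : ‖B‖ ≤ y) (hz : ‖C'‖ ≤ z)
    (hdx : ‖A' - A‖ ≤ dx) (hdy : ‖B' - B‖ ≤ dy) (hdz : ‖C' - C‖ ≤ dz) : ‖A' * B' * C' - A * B * C‖ ≤ dx * y * z + x * dy * z + x * y * dz := by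
  have h0x : 0 ≤ x := (norm_nonneg _).trans hx
  have h0y : 0 ≤ y := (norm_nonneg _).trans hy
  have h0dx : 0 ≤ dx := (norm_nonneg _).trans hdx
  have h0dy : 0 ≤ dy := (norm_nonneg _).trans hdy
  rw [prod3_sub_prod3_eq]
  refine norm_add₃_le.trans (add_le_add (add_le_add ?_ ?_) ?_)
  · calc ‖(A' - A) * B' * C'‖ ≤ ‖A' - A‖ * ‖B'‖ * ‖C'‖ := (norm_mul_le _ _).trans (mul_le_mul_of_nonneg_right (norm_mul_le _ _) (norm_nonneg _))
      _ ≤ dx * y * z := mul_le_mul (mul_le_mul hdx hy' (norm_nonneg _) h0dx) hz (norm_nonneg _) (mul_nonneg h0dx h0y)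
  · calc ‖A * (B' - B) * C'‖ ≤ ‖A‖ * ‖B' - B‖ * ‖C'‖ := (norm_mul_le _ _).trans (mul_le_mul_of_nonneg_right (norm_mul_le _ _) (norm_nonneg _))
      _ ≤ x * dy * z := mul_le_mul (mul_le_mul hx hdy (norm_nonneg _) h0x) hz (norm_nonneg _) (mul_nonneg h0x h0dy)
  · calc ‖A * B * (C' - C)‖ ≤ ‖A‖ * ‖B‖ * ‖C' - C‖ := (norm_mul_le _ _).trans (mul_le_mul_of_nonneg_right (norm_mul_le _ _) (norm_nonneg _))
      _ ≤ x * y * dz := mul_le_mul (mul_le_mul hx hy (norm_nonneg _) h0x) hdz (norm_nonneg _) (mul_nonneg h0x h0y)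

/-- THREE-TERM LEIBNIZ AGAINST `(−W)·B·1`, additive form: `‖A′B′C′ + W·B‖ ≤ dx·y·z + x·dy·z + x·y·dz` for `‖W‖ ≤ x`, `‖B‖, ‖B′‖ ≤ y`, `‖C′‖ ≤ z` and the letters
`‖A′ + W‖ ≤ dx`, `‖B′ − B‖ ≤ dy`, `‖C′ − 1‖ ≤ dz` (the previous lemma at `A = −W`, `C = 1`). [folklore] -/
theorem norm_prod3_add_mul_le_of_bounds {A' B B' C' W : 𝔅} {x y z dx dy dz : ℝ} (hx : ‖W‖ ≤ x) (hy' : ‖B'‖ ≤ y) (hy : ‖B‖ ≤ y) (hz : ‖C'‖ ≤ z)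
    (hdx : ‖A' + W‖ ≤ dx) (hdy : ‖B' - B‖ ≤ dy) (hdz : ‖C' - 1‖ ≤ dz) : ‖A' * B' * C' + W * B‖ ≤ dx * y * z + x * dy * z + x * y * dz := by
  have hx' : ‖-W‖ ≤ x := by rwa [norm_neg]
  have hdx' : ‖A' - -W‖ ≤ dx := by rwa [sub_neg_eq_add]
  have h := norm_prod3_sub_prod3_le_of_bounds (C := 1) hx' hy' hy hz hdx' hdy hdz
  have hid : A' * B' * C' - -W * B * 1 = A' * B' * C' + W * B := by noncomm_ring
  rwa [hid] at h

/-- TWO-TERM LEIBNIZ WITH LETTERS: `B′D′ − BD = (B′ − B)D′ + B(D′ − D)`, so `‖B′D′ − BD‖ ≤ dy·w + y·dw` for `‖B‖ ≤ y`, `‖D′‖ ≤ w`. [folklore] -/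
theorem norm_prod2_sub_prod2_le_of_bounds {B B' D D' : 𝔅} {y w dy dw : ℝ} (hy : ‖B‖ ≤ y) (hw : ‖D'‖ ≤ w) (hdy : ‖B' - B‖ ≤ dy) (hdw : ‖D' - D‖ ≤ dw) :
    ‖B' * D' - B * D‖ ≤ dy * w + y * dw := by
  have h0y : 0 ≤ y := (norm_nonneg _).trans hy
  have h0dy : 0 ≤ dy := (norm_nonneg _).trans hdy
  have hsplit : B' * D' - B * D = (B' - B) * D' + B * (D' - D) := by noncomm_ring
  rw [hsplit]
  exact (norm_add_le _ _).trans (add_le_add ((norm_mul_le _ _).trans (mul_le_mul hdy hw (norm_nonneg _) h0dy))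
    ((norm_mul_le _ _).trans (mul_le_mul hy hdw (norm_nonneg _) h0y)))

end Leibniz

section SpeciesLetters

variable {𝔅 : Type} [NormedRing 𝔅] [NormedAlgebra ℝ 𝔅]

/-- `Φ₁(s, 0) = 0` at every spacing. [folklore] -/
theorem Phi1_at_zero (s : ℝ) : Phi1 s (0 : 𝔅) = 0 := by
  unfold Phi1
  split_ifs <;> simp

/-- ★ `e^{ηZ} = 1 + η·Φ₁(η, Z)` at EVERY spacing (`Φ₁(η,Z) = η⁻¹(e^{ηZ} − 1)` for `η ≠ 0`, FILE 28 `Phi1_eq_smul`; trivial at `η = 0`). [folklore] -/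
theorem Phi0_eq_one_add_smul_Phi1 (η : ℝ) (Z : 𝔅) : Phi0 η Z = 1 + η • Phi1 η Z := by
  by_cases hη : η = 0
  · subst hη
    rw [Phi0_zero, zero_smul, add_zero]
  · rw [Phi1_eq_smul hη, smul_smul, mul_inv_cancel₀ hη, one_smul]
    abel

variable [CompleteSpace 𝔅]

/-- `‖Φ₁(s, Z)‖ ≤ e·r` on `0 ≤ s ≤ η₀`, `‖Z‖ ≤ r`, `η₀r ≤ 1` (13b `Phi1_lipschitz` against `Φ₁(s, 0) = 0`). [folklore] -/
theorem norm_Phi1_le_of_le {η₀ r s : ℝ} (hreg : η₀ * r ≤ 1) (hs0 : 0 ≤ s) (hs : s ≤ η₀) {Z : 𝔅} (hZ : ‖Z‖ ≤ r) : ‖Phi1 s Z‖ ≤ Real.exp 1 * r := by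
  have h := Phi1_lipschitz hreg s hs0 hs Z 0 hZ (by rw [norm_zero]; exact (norm_nonneg Z).trans hZ)
  rw [Phi1_at_zero, sub_zero, sub_zero] at h
  exact h.trans (mul_le_mul_of_nonneg_left hZ (Real.exp_pos 1).le)

/-- `‖Φ₁(s, Z) − Z‖ ≤ e·r²·s` (13b `Phi1_consistency`, `Φ₁(0, Z) = Z`). [folklore] -/
theorem norm_Phi1_sub_self_le {η₀ r s : ℝ} (hreg : η₀ * r ≤ 1) (hs0 : 0 ≤ s) (hs : s ≤ η₀) {Z : 𝔅} (hZ : ‖Z‖ ≤ r) : ‖Phi1 s Z - Z‖ ≤ Real.exp 1 * r ^ 2 * s := by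
  have h := Phi1_consistency hreg s hs0 hs Z hZ
  rwa [Phi1_zero] at h

/-- `‖Φ₁(s, −W) + W‖ ≤ e·r_B²·s`: the previous letter at `−W`. [folklore] -/
theorem norm_Phi1_neg_add_self_le {η₀ rB s : ℝ} (hregB : η₀ * rB ≤ 1) (hs0 : 0 ≤ s) (hs : s ≤ η₀) {W : 𝔅} (hW : ‖W‖ ≤ rB) :
    ‖Phi1 s (-W) + W‖ ≤ Real.exp 1 * rB ^ 2 * s := by
  have h := norm_Phi1_sub_self_le hregB hs0 hs (Z := -W) (by rwa [norm_neg])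
  rwa [sub_neg_eq_add] at h

/-- `‖e^{sW} − 1‖ ≤ e·r_B·s` (18 `Phi0_consistency`, `Φ₀(0, W) = 1`). [folklore] -/
theorem norm_Phi0_sub_one_le {η₀ rB s : ℝ} (hregB : η₀ * rB ≤ 1) (hs0 : 0 ≤ s) (hs : s ≤ η₀) {W : 𝔅} (hW : ‖W‖ ≤ rB) : ‖Phi0 s W - 1‖ ≤ Real.exp 1 * rB * s := by
  have h := Phi0_consistency hregB s hs0 hs W hW
  rwa [Phi0_zero] at h

/-- TWO SPACINGS, CRUDE: `‖e^{η′W′} − e^{ηW}‖ ≤ 2e·r_B·η` for `0 ≤ η′ ≤ η ≤ η₀`, `‖W‖, ‖W′‖ ≤ r_B` (both transports are `η`-close to `1`; rate one). [folklore] -/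
theorem norm_Phi0_sub_Phi0_le_two {η₀ rB η η' : ℝ} (hregB : η₀ * rB ≤ 1) (hη' : 0 ≤ η') (hη'η : η' ≤ η) (hη : η ≤ η₀) {W W' : 𝔅} (hW : ‖W‖ ≤ rB) (hW' : ‖W'‖ ≤ rB) :
    ‖Phi0 η' W' - Phi0 η W‖ ≤ 2 * (Real.exp 1 * rB) * η := by
  have hrB : 0 ≤ rB := (norm_nonneg W).trans hW
  have h1 := norm_Phi0_sub_one_le hregB hη' (hη'η.trans hη) hW'
  have h2 := norm_Phi0_sub_one_le hregB (hη'.trans hη'η) hη hW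
  have hsplit : Phi0 η' W' - Phi0 η W = (Phi0 η' W' - 1) - (Phi0 η W - 1) := by abel
  rw [hsplit]
  calc ‖(Phi0 η' W' - 1) - (Phi0 η W - 1)‖ ≤ ‖Phi0 η' W' - 1‖ + ‖Phi0 η W - 1‖ := norm_sub_le _ _
    _ ≤ Real.exp 1 * rB * η' + Real.exp 1 * rB * η := add_le_add h1 h2
    _ ≤ Real.exp 1 * rB * η + Real.exp 1 * rB * η := by gcongr
    _ = 2 * (Real.exp 1 * rB) * η := by ring

/-- ★ **THE EXACT η²-STRUCTURE OF THE CONJUGATED-EXPONENTIAL DEFECT**: for any `Z₊, Z₋, W` in a complete real normed algebra and any `η`,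
`e^{ηZ₊} − e^{−ηW}·e^{ηZ₋}·e^{ηW} = η·(Z₊ − Z₋) + η²·(Φ₂(η,Z₊) − Φ₂(η,Z₋)) − η²·(Φ₁(η,−W)·Φ₁(η,Z₋)·e^{ηW} + Φ₁(η,Z₋)·Φ₁(η,W))` — the first difference through
`e^{ηZ} = 1 + ηZ + η²Φ₂(η,Z)`, the conjugation defect through file 5's `conj_defect_identity` with `e^{±ηW} − 1 = ηΦ₁(η,±W)`. [folklore] -/
theorem Phi0_sub_conj_eq (η : ℝ) (Zp Zm W : 𝔅) :
    Phi0 η Zp - Phi0 η (-W) * Phi0 η Zm * Phi0 η W =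
      η • (Zp - Zm) + (η * η) • (Phi2 η Zp - Phi2 η Zm) - (η * η) • (Phi1 η (-W) * Phi1 η Zm * Phi0 η W + Phi1 η Zm * Phi1 η W) := by
  have hPQ : Phi0 η (-W) * Phi0 η W = 1 := Phi0_neg_mul_Phi0 η W
  have h1 : Phi0 η Zp - Phi0 η (-W) * Phi0 η Zm * Phi0 η W = (Phi0 η Zp - Phi0 η Zm) + (Phi0 η Zm - Phi0 η (-W) * Phi0 η Zm * Phi0 η W) := by abel
  have hA : Phi0 η Zp - Phi0 η Zm = η • (Zp - Zm) + (η * η) • (Phi2 η Zp - Phi2 η Zm) := by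
    rw [Phi0_eq_one_add_smul_Phi1 η Zp, Phi0_eq_one_add_smul_Phi1 η Zm, Phi1_eq_add_smul_Phi2 η Zp, Phi1_eq_add_smul_Phi2 η Zm, mul_smul]
    simp only [smul_add, smul_sub]
    abel
  have hB : Phi0 η Zm - Phi0 η (-W) * Phi0 η Zm * Phi0 η W = -((η * η) • (Phi1 η (-W) * Phi1 η Zm * Phi0 η W + Phi1 η Zm * Phi1 η W)) := by
    rw [conj_defect_identity (M := Phi0 η Zm) hPQ]
    have e1 : Phi0 η (-W) - 1 = η • Phi1 η (-W) := by rw [Phi0_eq_one_add_smul_Phi1]; abel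
    have e2 : Phi0 η Zm - 1 = η • Phi1 η Zm := by rw [Phi0_eq_one_add_smul_Phi1]; abel
    have e3 : Phi0 η W - 1 = η • Phi1 η W := by rw [Phi0_eq_one_add_smul_Phi1]; abel
    rw [e1, e2, e3, smul_add]
    simp only [smul_mul_assoc, mul_smul_comm, smul_smul]
  rw [h1, hA, hB]
  abel

end SpeciesLetters

/-! ## §2 The generator form of `η⁻²(S_μ − R₋ᵀS₋R₋)` and the (3.52) dictionary -/

section Generator

variable {X X' ι J : Type} [Fintype ι] [DecidableEq ι] {𝔄 : Type} [NormedRing 𝔄] [NormedAlgebra ℝ 𝔄] [CompleteSpace 𝔄] (e : 𝔄 ≃L[ℝ] (ι → ℝ))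
variable (η : ℝ) (τ : J → X ≃ X) (Z W : J → X → (𝔄 →L[ℝ] 𝔄))

/-- THE GENERATOR FORM OF THE η⁻²-RESCALED COVARIANT SHIFT DEFECT of `S = e^{ηZ}` along the background `R = e^{ηW}` (`Z₊ = Z_μ(x)`, `Z₋ = Z_μ(x − e_μ)`,
`W₋ = W_μ(x − e_μ)`): `η⁻¹(Z₊ − Z₋) + (Φ₂(η,Z₊) − Φ₂(η,Z₋)) − (Φ₁(η,−W₋)·Φ₁(η,Z₋)·e^{ηW₋} + Φ₁(η,Z₋)·Φ₁(η,W₋))` — by §1 `Phi0_sub_conj_eq` this is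
`η⁻²(e^{ηZ₊} − e^{−ηW₋}e^{ηZ₋}e^{ηW₋})` for `η ≠ 0`. [cite: Balaban1985BackgroundPropagators, (3.52) p.400 (`D^{η*}_U A′`, `F′_{1,k}`: shape)] -/
def covGradGen (μ : J) (x : X) : 𝔄 →L[ℝ] 𝔄 :=
  η⁻¹ • (Z μ x - Z μ ((τ μ).symm x)) + (Phi2 η (Z μ x) - Phi2 η (Z μ ((τ μ).symm x))) -
    (Phi1 η (-(W μ ((τ μ).symm x))) * Phi1 η (Z μ ((τ μ).symm x)) * Phi0 η (W μ ((τ μ).symm x)) + Phi1 η (Z μ ((τ μ).symm x)) * Phi1 η (W μ ((τ μ).symm x)))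

/-- `‖e^{sW}‖ ≤ 1 + e` for an operator `W` with `‖W‖ ≤ r_B`, `0 ≤ s ≤ η₀`, `η₀r_B ≤ 1` (`‖e^{sW} − 1‖ ≤ e r_B s ≤ e`, `‖id‖ ≤ 1`). [folklore] -/
theorem norm_Phi0_clm_le {η₀ rB s : ℝ} (hregB : η₀ * rB ≤ 1) (hs0 : 0 ≤ s) (hs : s ≤ η₀) {T : 𝔄 →L[ℝ] 𝔄} (hT : ‖T‖ ≤ rB) :
    ‖Phi0 s T‖ ≤ 1 + Real.exp 1 := by
  have hrB : 0 ≤ rB := (norm_nonneg T).trans hT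
  have h0 := norm_Phi0_sub_one_le (𝔅 := 𝔄 →L[ℝ] 𝔄) hregB hs0 hs hT
  have h1 : ‖Phi0 s T‖ ≤ ‖Phi0 s T - 1‖ + ‖(1 : 𝔄 →L[ℝ] 𝔄)‖ := by
    have := norm_add_le (Phi0 s T - 1) (1 : 𝔄 →L[ℝ] 𝔄); rwa [sub_add_cancel] at this
  have h2 : ‖(1 : 𝔄 →L[ℝ] 𝔄)‖ ≤ 1 := by rw [ContinuousLinearMap.one_def]; exact ContinuousLinearMap.norm_id_le
  have h3 : Real.exp 1 * (rB * s) ≤ Real.exp 1 * 1 :=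
    mul_le_mul_of_nonneg_left ((mul_le_mul_of_nonneg_left hs hrB).trans (by rw [mul_comm]; exact hregB)) (Real.exp_pos 1).le
  linarith [mul_assoc (Real.exp 1) rB s]

/-- ★★ **THE η⁻²-RESCALED COVARIANT SHIFT DEFECT IN GENERATOR COORDINATES, EXACTLY.**  For `η ≠ 0`, `S = expTrField e η Z`, `R = expTrField e η W` and file 5's
orthogonal-model identification `hRt : R_μ(y)ᵀ = coordMat e (e^{−ηW_μ(y)})`: `(η⁻¹η⁻¹)•(S_μ(x) − R₋ᵀS₋R₋) = coordMat e (covGradGen η τ Z W μ x)` (coordinates are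
multiplicative and linear; §1 `Phi0_sub_conj_eq`). [cite: Balaban1985BackgroundPropagators, (3.52) p.400 (shape)] -/
theorem smul_covShiftDefect_exp_eq_coordMat (hη : η ≠ 0) (hRt : ∀ μ y, (expTrField e η W μ y)ᵀ = coordMat e (Phi0 η (-(W μ y)))) (μ : J) (x : X) :
    (η⁻¹ * η⁻¹) • covShiftDefect τ (expTrField e η W) (expTrField e η Z) μ x = coordMat e (covGradGen η τ Z W μ x) := by
  have hcoord : covShiftDefect τ (expTrField e η W) (expTrField e η Z) μ x =
      coordMat e (Phi0 η (Z μ x) - Phi0 η (-(W μ ((τ μ).symm x))) * Phi0 η (Z μ ((τ μ).symm x)) * Phi0 η (W μ ((τ μ).symm x))) := by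
    rw [covShiftDefect, hRt, expTrField_apply, expTrField_apply, expTrField_apply, ← coordMat_mul, ← coordMat_mul, ← coordMat_sub]
  rw [hcoord, Phi0_sub_conj_eq, ← coordMat_smul]
  congr 1
  rw [smul_sub, smul_add, smul_smul, smul_smul, smul_smul, inv_mul_cancel_right₀ hη, show η⁻¹ * η⁻¹ * (η * η) = 1 by field_simp, one_smul, one_smul,
    covGradGen]

/-- THE REMAINDER LETTER of the (3.52) dictionary (crude polynomial): `e r g + e²(1+e) r r_B² + e(1+e) r² r_B + e² r r_B² + e² r² r_B + e r r_B²`. [folklore] -/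
def covDerivRem (r rB g : ℝ) : ℝ :=
  Real.exp 1 * r * g + (Real.exp 1 * rB ^ 2 * (Real.exp 1 * r) * (1 + Real.exp 1) + rB * (Real.exp 1 * r ^ 2) * (1 + Real.exp 1) +
    rB * (Real.exp 1 * r) * (Real.exp 1 * rB)) + (Real.exp 1 * r ^ 2 * (Real.exp 1 * rB) + r * (Real.exp 1 * rB ^ 2))

/-- ★★ **THE (3.52) DICTIONARY: `η⁻²(S_μ − R₋ᵀS₋R₋)` IS THE GENERATOR's COVARIANT LATTICE DERIVATIVE `∇Z + [W₋, Z₋]` UP TO `O(η)`.**  For generator fields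
`‖Z‖ ≤ r`, `‖W‖ ≤ r_B`, the lattice-gradient letter `‖Z_μ(x) − Z_μ(x − e_μ)‖ ≤ ηg` and regimes `0 ≤ η ≤ η₀`, `η₀r ≤ 1`, `η₀r_B ≤ 1`:
`‖covGradGen η τ Z W μ x − (η⁻¹(Z₊ − Z₋) + (W₋Z₋ − Z₋W₋))‖ ≤ η·covDerivRem r r_B g` — the `Φ₂` difference is `≤ e r·ηg` (13b `Phi2_lipschitz`), the products are
`(−W₋)Z₋ + Z₋W₋ + O(η)` by Leibniz against `Φ₁(η,Z) = Z + O(η)`, `e^{ηW} = 1 + O(η)`.  (At `Z = ad A′`, `W = ad B`: `∇(ad A′) + [ad B, ad A′] = ad(∇A′ + [B, A′])`, the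
print's `D^{η}_U A′` read through ad.) [cite: Balaban1985BackgroundPropagators, (3.37) p.396 (`|∇^η_U A′|`: shape), (3.52) p.400 (`D^{η*}_U A′`: shape)] -/
theorem norm_covGradGen_sub_covDeriv_le {η₀ r rB g : ℝ} (hreg : η₀ * r ≤ 1) (hregB : η₀ * rB ≤ 1) (hη0 : 0 ≤ η) (hηη₀ : η ≤ η₀)
    (hZ : ∀ μ x, ‖Z μ x‖ ≤ r) (hW : ∀ μ x, ‖W μ x‖ ≤ rB) (hgrad : ∀ μ x, ‖Z μ x - Z μ ((τ μ).symm x)‖ ≤ η * g) (μ : J) (x : X) :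
    ‖covGradGen η τ Z W μ x - (η⁻¹ • (Z μ x - Z μ ((τ μ).symm x)) +
        (W μ ((τ μ).symm x) * Z μ ((τ μ).symm x) - Z μ ((τ μ).symm x) * W μ ((τ μ).symm x)))‖ ≤ η * covDerivRem r rB g := by
  have hr : 0 ≤ r := (norm_nonneg _).trans (hZ μ x)
  have he1 : (1 : ℝ) ≤ Real.exp 1 := by have := Real.add_one_le_exp (1 : ℝ); linarith
  -- abbreviations (all in the complete normed algebra `𝔄 →L[ℝ] 𝔄`)
  have hZm := hZ μ ((τ μ).symm x)
  have hWm := hW μ ((τ μ).symm x)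
  -- (i) the Φ₂ difference
  have hi : ‖Phi2 η (Z μ x) - Phi2 η (Z μ ((τ μ).symm x))‖ ≤ Real.exp 1 * r * (η * g) :=
    (Phi2_lipschitz (𝔸 := 𝔄 →L[ℝ] 𝔄) hreg η hη0 hηη₀ _ _ (hZ μ x) hZm).trans (mul_le_mul_of_nonneg_left (hgrad μ x) (by positivity))
  -- (ii) the triple product against (−W₋)·Z₋·1 (additive form)
  have hii : ‖Phi1 η (-(W μ ((τ μ).symm x))) * Phi1 η (Z μ ((τ μ).symm x)) * Phi0 η (W μ ((τ μ).symm x)) + W μ ((τ μ).symm x) * Z μ ((τ μ).symm x)‖ ≤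
      Real.exp 1 * rB ^ 2 * η * (Real.exp 1 * r) * (1 + Real.exp 1) + rB * (Real.exp 1 * r ^ 2 * η) * (1 + Real.exp 1) + rB * (Real.exp 1 * r) * (Real.exp 1 * rB * η) :=
    norm_prod3_add_mul_le_of_bounds hWm (norm_Phi1_le_of_le (𝔅 := 𝔄 →L[ℝ] 𝔄) hreg hη0 hηη₀ hZm) (hZm.trans (le_mul_of_one_le_left hr he1))
      (norm_Phi0_clm_le hregB hη0 hηη₀ hWm) (norm_Phi1_neg_add_self_le (𝔅 := 𝔄 →L[ℝ] 𝔄) hregB hη0 hηη₀ hWm)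
      (norm_Phi1_sub_self_le (𝔅 := 𝔄 →L[ℝ] 𝔄) hreg hη0 hηη₀ hZm) (norm_Phi0_sub_one_le (𝔅 := 𝔄 →L[ℝ] 𝔄) hregB hη0 hηη₀ hWm)
  -- (iii) the double product against Z₋·W₋
  have hiii : ‖Phi1 η (Z μ ((τ μ).symm x)) * Phi1 η (W μ ((τ μ).symm x)) - Z μ ((τ μ).symm x) * W μ ((τ μ).symm x)‖ ≤
      Real.exp 1 * r ^ 2 * η * (Real.exp 1 * rB) + r * (Real.exp 1 * rB ^ 2 * η) :=
    norm_prod2_sub_prod2_le_of_bounds hZm (norm_Phi1_le_of_le (𝔅 := 𝔄 →L[ℝ] 𝔄) hregB hη0 hηη₀ hWm)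
      (norm_Phi1_sub_self_le (𝔅 := 𝔄 →L[ℝ] 𝔄) hreg hη0 hηη₀ hZm) (norm_Phi1_sub_self_le (𝔅 := 𝔄 →L[ℝ] 𝔄) hregB hη0 hηη₀ hWm)
  have hsplit : covGradGen η τ Z W μ x - (η⁻¹ • (Z μ x - Z μ ((τ μ).symm x)) +
      (W μ ((τ μ).symm x) * Z μ ((τ μ).symm x) - Z μ ((τ μ).symm x) * W μ ((τ μ).symm x))) =
      (Phi2 η (Z μ x) - Phi2 η (Z μ ((τ μ).symm x))) -
        ((Phi1 η (-(W μ ((τ μ).symm x))) * Phi1 η (Z μ ((τ μ).symm x)) * Phi0 η (W μ ((τ μ).symm x)) + W μ ((τ μ).symm x) * Z μ ((τ μ).symm x)) +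
          (Phi1 η (Z μ ((τ μ).symm x)) * Phi1 η (W μ ((τ μ).symm x)) - Z μ ((τ μ).symm x) * W μ ((τ μ).symm x))) := by
    rw [covGradGen]
    abel
  rw [hsplit]
  calc _ ≤ ‖Phi2 η (Z μ x) - Phi2 η (Z μ ((τ μ).symm x))‖ +
        ‖(Phi1 η (-(W μ ((τ μ).symm x))) * Phi1 η (Z μ ((τ μ).symm x)) * Phi0 η (W μ ((τ μ).symm x)) + W μ ((τ μ).symm x) * Z μ ((τ μ).symm x)) +
          (Phi1 η (Z μ ((τ μ).symm x)) * Phi1 η (W μ ((τ μ).symm x)) - Z μ ((τ μ).symm x) * W μ ((τ μ).symm x))‖ := norm_sub_le _ _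
    _ ≤ Real.exp 1 * r * (η * g) + (Real.exp 1 * rB ^ 2 * η * (Real.exp 1 * r) * (1 + Real.exp 1) + rB * (Real.exp 1 * r ^ 2 * η) * (1 + Real.exp 1) +
          rB * (Real.exp 1 * r) * (Real.exp 1 * rB * η) + (Real.exp 1 * r ^ 2 * η * (Real.exp 1 * rB) + r * (Real.exp 1 * rB ^ 2 * η))) :=
        add_le_add hi ((norm_add_le _ _).trans (add_le_add hii hiii))
    _ = η * covDerivRem r rB g := by unfold covDerivRem; ring

end Generator

/-! ## §3 The η-fit of the covariant-gradient field from generator-level fits (file 4's `o_g`) -/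

section Fit

variable {X X' ι J : Type} [Fintype ι] [DecidableEq ι] {𝔄 : Type} [NormedRing 𝔄] [NormedAlgebra ℝ 𝔄] [CompleteSpace 𝔄] (e : 𝔄 ≃L[ℝ] (ι → ℝ))
variable (η η' : ℝ) (τ : J → X ≃ X) (τ' : J → X' ≃ X') (π : X' → X) (Z W : J → X → (𝔄 →L[ℝ] 𝔄)) (Z' W' : J → X' → (𝔄 →L[ℝ] 𝔄))

/-- THE FIT LETTER of the covariant-gradient field (RATE ONE: affine in `o_D, o_t, o_W, η`): `o_D + 2e r g·η + [three-term Leibniz letters of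
`Φ₁(−W₋)Φ₁(Z₋)e^{ηW₋}`] + [two-term Leibniz letters of `Φ₁(Z₋)Φ₁(W₋)`]` with factor sizes `e r_B, e r, 1 + e` and factor fits `e·o_W + 2e r_B²η`,
`e·o_t + 2e r²η`, `2e r_B η`. [folklore] -/
def gradFitLetter (r rB g oD ot oW η : ℝ) : ℝ :=
  oD + 2 * (Real.exp 1 * r * g) * η +
    ((Real.exp 1 * oW + 2 * (Real.exp 1 * rB ^ 2) * η) * (Real.exp 1 * r) * (1 + Real.exp 1) +
        Real.exp 1 * rB * (Real.exp 1 * ot + 2 * (Real.exp 1 * r ^ 2) * η) * (1 + Real.exp 1) +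
        Real.exp 1 * rB * (Real.exp 1 * r) * (2 * (Real.exp 1 * rB) * η) +
      ((Real.exp 1 * ot + 2 * (Real.exp 1 * r ^ 2) * η) * (Real.exp 1 * rB) + Real.exp 1 * r * (Real.exp 1 * oW + 2 * (Real.exp 1 * rB ^ 2) * η)))

/-- The fit letter is nonnegative for nonnegative inputs. [folklore] -/
theorem gradFitLetter_nonneg {r rB g oD ot oW η : ℝ} (hr : 0 ≤ r) (hrB : 0 ≤ rB) (hg : 0 ≤ g) (hoD : 0 ≤ oD) (hot : 0 ≤ ot) (hoW : 0 ≤ oW) (hη : 0 ≤ η) :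
    0 ≤ gradFitLetter r rB g oD ot oW η := by
  unfold gradFitLetter; positivity

/-- ★★ **THE TWO-SPACING FIT OF THE GENERATOR FORM.**  Spacings `0 < η′ ≤ η ≤ η₀`, regimes `η₀r ≤ 1`, `η₀r_B ≤ 1`; generator fields `Z, W` (coarse grid, steps `τ`) and
`Z′, W′` (fine grid, steps `τ′`, block map `π`) with `‖Z‖, ‖Z′‖ ≤ r`, `‖W‖, ‖W′‖ ≤ r_B`, lattice-gradient letters `‖Z₊ − Z₋‖ ≤ ηg`, `‖Z′₊ − Z′₋‖ ≤ η′g`; the fits: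
of the lattice DERIVATIVE `‖η′⁻¹(Z′₊ − Z′₋)(x′) − η⁻¹(Z₊ − Z₋)(πx′)‖ ≤ o_D`, of the generator at the translated points `‖Z′_μ((τ′_μ)⁻¹x′) − Z_μ((τ_μ)⁻¹(πx′))‖ ≤ o_t`, and of
the background generator there `≤ o_W`.  Then `‖covGradGen η′ τ′ Z′ W′ μ x′ − covGradGen η τ Z W μ (πx′)‖ ≤ gradFitLetter r r_B g o_D o_t o_W η` (13b `fit_Phi1`,
`Phi2_lipschitz`; §1 Leibniz). [cite: Balaban1985BackgroundPropagators, (3.37) p.396, (3.52) p.400 (shapes)] -/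
theorem fit_covGradGen {η₀ r rB g oD ot oW : ℝ} (hreg : η₀ * r ≤ 1) (hregB : η₀ * rB ≤ 1) (hη' : 0 < η') (hη'η : η' ≤ η) (hηη₀ : η ≤ η₀)
    (hZ : ∀ μ x, ‖Z μ x‖ ≤ r) (hZ' : ∀ μ x', ‖Z' μ x'‖ ≤ r) (hW : ∀ μ x, ‖W μ x‖ ≤ rB) (hW' : ∀ μ x', ‖W' μ x'‖ ≤ rB)
    (hgrad : ∀ μ x, ‖Z μ x - Z μ ((τ μ).symm x)‖ ≤ η * g) (hgrad' : ∀ μ x', ‖Z' μ x' - Z' μ ((τ' μ).symm x')‖ ≤ η' * g)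
    (hfitD : ∀ μ x', ‖η'⁻¹ • (Z' μ x' - Z' μ ((τ' μ).symm x')) - η⁻¹ • (Z μ (π x') - Z μ ((τ μ).symm (π x')))‖ ≤ oD)
    (hfitT : ∀ μ x', ‖Z' μ ((τ' μ).symm x') - Z μ ((τ μ).symm (π x'))‖ ≤ ot) (hfitW : ∀ μ x', ‖W' μ ((τ' μ).symm x') - W μ ((τ μ).symm (π x'))‖ ≤ oW)
    (μ : J) (x' : X') :
    ‖covGradGen η' τ' Z' W' μ x' - covGradGen η τ Z W μ (π x')‖ ≤ gradFitLetter r rB g oD ot oW η := by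
  have hη : 0 < η := lt_of_lt_of_le hη' hη'η
  have hη'₀ : η' ≤ η₀ := hη'η.trans hηη₀
  have hr : 0 ≤ r := (norm_nonneg _).trans (hZ μ (π x'))
  have hg : 0 ≤ g := le_of_mul_le_mul_left (by rw [mul_zero]; exact (norm_nonneg _).trans (hgrad μ (π x'))) hη
  -- the points and the letters of the factors
  set y := (τ μ).symm (π x') with hy
  set y' := (τ' μ).symm x' with hy'
  have hZm := hZ μ y
  have hZm' := hZ' μ y'
  have hWm := hW μ y
  have hWm' := hW' μ y'
  have hWn : ‖-(W μ y)‖ ≤ rB := by rw [norm_neg]; exact hWm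
  -- (0) the lattice-derivative fit is the hypothesis; (i) the Φ₂ differences, both O(η)
  have hi : ‖(Phi2 η' (Z' μ x') - Phi2 η' (Z' μ y')) - (Phi2 η (Z μ (π x')) - Phi2 η (Z μ y))‖ ≤ 2 * (Real.exp 1 * r * g) * η := by
    have a1 : ‖Phi2 η' (Z' μ x') - Phi2 η' (Z' μ y')‖ ≤ Real.exp 1 * r * (η' * g) :=
      (Phi2_lipschitz (𝔸 := 𝔄 →L[ℝ] 𝔄) hreg η' hη'.le hη'₀ _ _ (hZ' μ x') hZm').trans (mul_le_mul_of_nonneg_left (hgrad' μ x') (by positivity))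
    have a2 : ‖Phi2 η (Z μ (π x')) - Phi2 η (Z μ y)‖ ≤ Real.exp 1 * r * (η * g) :=
      (Phi2_lipschitz (𝔸 := 𝔄 →L[ℝ] 𝔄) hreg η hη.le hηη₀ _ _ (hZ μ (π x')) hZm).trans (mul_le_mul_of_nonneg_left (hgrad μ (π x')) (by positivity))
    calc _ ≤ ‖Phi2 η' (Z' μ x') - Phi2 η' (Z' μ y')‖ + ‖Phi2 η (Z μ (π x')) - Phi2 η (Z μ y)‖ := norm_sub_le _ _
      _ ≤ Real.exp 1 * r * (η' * g) + Real.exp 1 * r * (η * g) := add_le_add a1 a2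
      _ ≤ Real.exp 1 * r * (η * g) + Real.exp 1 * r * (η * g) := by gcongr
      _ = 2 * (Real.exp 1 * r * g) * η := by ring
  -- the factor fits (13b `fit_Phi1` at the translated points; crude for the transport)
  have hfA : ‖Phi1 η' (-(W' μ y')) - Phi1 η (-(W μ y))‖ ≤ Real.exp 1 * oW + 2 * (Real.exp 1 * rB ^ 2) * η :=
    fit_Phi1 (𝔸 := 𝔄 →L[ℝ] 𝔄) π hregB hη'.le hη'η hηη₀ (a' := fun x' => -(W' μ ((τ' μ).symm x'))) (a := fun x => -(W μ ((τ μ).symm x)))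
      (fun x' => by rw [norm_neg]; exact hW' μ _) (fun x => by rw [norm_neg]; exact hW μ _) (o := fun _ => oW)
      (fun x' => by rw [neg_sub_neg, norm_sub_rev]; exact hfitW μ x') x'
  have hfB : ‖Phi1 η' (Z' μ y') - Phi1 η (Z μ y)‖ ≤ Real.exp 1 * ot + 2 * (Real.exp 1 * r ^ 2) * η :=
    fit_Phi1 (𝔸 := 𝔄 →L[ℝ] 𝔄) π hreg hη'.le hη'η hηη₀ (a' := fun x' => Z' μ ((τ' μ).symm x')) (a := fun x => Z μ ((τ μ).symm x))
      (fun x' => hZ' μ _) (fun x => hZ μ _) (o := fun _ => ot) (fun x' => hfitT μ x') x'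
  have hfC : ‖Phi0 η' (W' μ y') - Phi0 η (W μ y)‖ ≤ 2 * (Real.exp 1 * rB) * η :=
    norm_Phi0_sub_Phi0_le_two (𝔅 := 𝔄 →L[ℝ] 𝔄) hregB hη'.le hη'η hηη₀ hWm hWm'
  have hfD : ‖Phi1 η' (W' μ y') - Phi1 η (W μ y)‖ ≤ Real.exp 1 * oW + 2 * (Real.exp 1 * rB ^ 2) * η :=
    fit_Phi1 (𝔸 := 𝔄 →L[ℝ] 𝔄) π hregB hη'.le hη'η hηη₀ (a' := fun x' => W' μ ((τ' μ).symm x')) (a := fun x => W μ ((τ μ).symm x))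
      (fun x' => hW' μ _) (fun x => hW μ _) (o := fun _ => oW) (fun x' => hfitW μ x') x'
  -- (ii) the triple product, (iii) the double product
  have hii : ‖Phi1 η' (-(W' μ y')) * Phi1 η' (Z' μ y') * Phi0 η' (W' μ y') - Phi1 η (-(W μ y)) * Phi1 η (Z μ y) * Phi0 η (W μ y)‖ ≤
      (Real.exp 1 * oW + 2 * (Real.exp 1 * rB ^ 2) * η) * (Real.exp 1 * r) * (1 + Real.exp 1) +
        Real.exp 1 * rB * (Real.exp 1 * ot + 2 * (Real.exp 1 * r ^ 2) * η) * (1 + Real.exp 1) + Real.exp 1 * rB * (Real.exp 1 * r) * (2 * (Real.exp 1 * rB) * η) :=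
    norm_prod3_sub_prod3_le_of_bounds (norm_Phi1_le_of_le (𝔅 := 𝔄 →L[ℝ] 𝔄) hregB hη.le hηη₀ hWn) (norm_Phi1_le_of_le (𝔅 := 𝔄 →L[ℝ] 𝔄) hreg hη'.le hη'₀ hZm')
      (norm_Phi1_le_of_le (𝔅 := 𝔄 →L[ℝ] 𝔄) hreg hη.le hηη₀ hZm) (norm_Phi0_clm_le hregB hη'.le hη'₀ hWm') hfA hfB hfC
  have hiii : ‖Phi1 η' (Z' μ y') * Phi1 η' (W' μ y') - Phi1 η (Z μ y) * Phi1 η (W μ y)‖ ≤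
      (Real.exp 1 * ot + 2 * (Real.exp 1 * r ^ 2) * η) * (Real.exp 1 * rB) + Real.exp 1 * r * (Real.exp 1 * oW + 2 * (Real.exp 1 * rB ^ 2) * η) :=
    norm_prod2_sub_prod2_le_of_bounds (norm_Phi1_le_of_le (𝔅 := 𝔄 →L[ℝ] 𝔄) hreg hη.le hηη₀ hZm) (norm_Phi1_le_of_le (𝔅 := 𝔄 →L[ℝ] 𝔄) hregB hη'.le hη'₀ hWm')
      hfB hfD
  -- assemble
  have hsplit : covGradGen η' τ' Z' W' μ x' - covGradGen η τ Z W μ (π x') =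
      (η'⁻¹ • (Z' μ x' - Z' μ y') - η⁻¹ • (Z μ (π x') - Z μ y)) + ((Phi2 η' (Z' μ x') - Phi2 η' (Z' μ y')) - (Phi2 η (Z μ (π x')) - Phi2 η (Z μ y))) -
        ((Phi1 η' (-(W' μ y')) * Phi1 η' (Z' μ y') * Phi0 η' (W' μ y') - Phi1 η (-(W μ y)) * Phi1 η (Z μ y) * Phi0 η (W μ y)) +
          (Phi1 η' (Z' μ y') * Phi1 η' (W' μ y') - Phi1 η (Z μ y) * Phi1 η (W μ y))) := by
    rw [covGradGen, covGradGen, ← hy, ← hy']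
    abel
  rw [hsplit]
  calc _ ≤ ‖η'⁻¹ • (Z' μ x' - Z' μ y') - η⁻¹ • (Z μ (π x') - Z μ y)‖ + ‖(Phi2 η' (Z' μ x') - Phi2 η' (Z' μ y')) - (Phi2 η (Z μ (π x')) - Phi2 η (Z μ y))‖ +
        ‖(Phi1 η' (-(W' μ y')) * Phi1 η' (Z' μ y') * Phi0 η' (W' μ y') - Phi1 η (-(W μ y)) * Phi1 η (Z μ y) * Phi0 η (W μ y)) +
          (Phi1 η' (Z' μ y') * Phi1 η' (W' μ y') - Phi1 η (Z μ y) * Phi1 η (W μ y))‖ := (norm_sub_le _ _).trans (add_le_add (norm_add_le _ _) le_rfl)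
    _ ≤ oD + 2 * (Real.exp 1 * r * g) * η +
        ((Real.exp 1 * oW + 2 * (Real.exp 1 * rB ^ 2) * η) * (Real.exp 1 * r) * (1 + Real.exp 1) +
            Real.exp 1 * rB * (Real.exp 1 * ot + 2 * (Real.exp 1 * r ^ 2) * η) * (1 + Real.exp 1) +
            Real.exp 1 * rB * (Real.exp 1 * r) * (2 * (Real.exp 1 * rB) * η) +
          ((Real.exp 1 * ot + 2 * (Real.exp 1 * r ^ 2) * η) * (Real.exp 1 * rB) + Real.exp 1 * r * (Real.exp 1 * oW + 2 * (Real.exp 1 * rB ^ 2) * η))) :=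
        add_le_add (add_le_add (by rw [hy, hy']; exact hfitD μ x') hi) ((norm_add_le _ _).trans (add_le_add hii hiii))
    _ = gradFitLetter r rB g oD ot oW η := rfl

/-- ★★★ **FILE 4's COVARIANT-GRADIENT FIT `o_g` INHABITED FROM GENERATOR-LEVEL DATA.**  Same data as `fit_covGradGen`, at `S = expTrField e η Z`, `R = expTrField e η W`
(coarse) and `S′ = expTrField e η′ Z′`, `R′ = expTrField e η′ W′` (fine), with file 5's orthogonal-model identification `hRt` on both grids: the hypothesis `hfg` of
`hasMaj_idef_curvDressed` holds with `o_g = κ_e·gradFitLetter r r_B g o_D o_t o_W η` —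
`|((η′⁻¹η′⁻¹)•covShiftDefect τ′ R′ S′ μ x′ − (η⁻¹η⁻¹)•covShiftDefect τ R S μ (πx′))_{ij}| ≤ κ_e·gradFitLetter …` (§2 exact generator form + §3 fit + file 5's entry letter).
[cite: Balaban1985BackgroundPropagators, (3.37) p.396, (3.52) p.400 (shapes)] -/
theorem fit_covShiftDefect_exp {η₀ r rB g oD ot oW : ℝ} (hreg : η₀ * r ≤ 1) (hregB : η₀ * rB ≤ 1) (hη' : 0 < η') (hη'η : η' ≤ η) (hηη₀ : η ≤ η₀)
    (hZ : ∀ μ x, ‖Z μ x‖ ≤ r) (hZ' : ∀ μ x', ‖Z' μ x'‖ ≤ r) (hW : ∀ μ x, ‖W μ x‖ ≤ rB) (hW' : ∀ μ x', ‖W' μ x'‖ ≤ rB)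
    (hgrad : ∀ μ x, ‖Z μ x - Z μ ((τ μ).symm x)‖ ≤ η * g) (hgrad' : ∀ μ x', ‖Z' μ x' - Z' μ ((τ' μ).symm x')‖ ≤ η' * g)
    (hfitD : ∀ μ x', ‖η'⁻¹ • (Z' μ x' - Z' μ ((τ' μ).symm x')) - η⁻¹ • (Z μ (π x') - Z μ ((τ μ).symm (π x')))‖ ≤ oD)
    (hfitT : ∀ μ x', ‖Z' μ ((τ' μ).symm x') - Z μ ((τ μ).symm (π x'))‖ ≤ ot) (hfitW : ∀ μ x', ‖W' μ ((τ' μ).symm x') - W μ ((τ μ).symm (π x'))‖ ≤ oW)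
    (hRt : ∀ μ y, (expTrField e η W μ y)ᵀ = coordMat e (Phi0 η (-(W μ y)))) (hRt' : ∀ μ y', (expTrField e η' W' μ y')ᵀ = coordMat e (Phi0 η' (-(W' μ y'))))
    (μ : J) (x' : X') (i j : ι) :
    |((η'⁻¹ * η'⁻¹) • covShiftDefect τ' (expTrField e η' W') (expTrField e η' Z') μ x' -
        (η⁻¹ * η⁻¹) • covShiftDefect τ (expTrField e η W) (expTrField e η Z) μ (π x')) i j| ≤ basisConst e * gradFitLetter r rB g oD ot oW η := by
  have hη : 0 < η := lt_of_lt_of_le hη' hη'η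
  rw [smul_covShiftDefect_exp_eq_coordMat e η' τ' Z' W' hη'.ne' hRt', smul_covShiftDefect_exp_eq_coordMat e η τ Z W hη.ne' hRt]
  exact (abs_coordMat_sub_entry_le e _ _ i j).trans (mul_le_mul_of_nonneg_left
    (fit_covGradGen η η' τ τ' π Z W Z' W' hreg hregB hη' hη'η hηη₀ hZ hZ' hW hW' hgrad hgrad' hfitD hfitT hfitW μ x') (basisConst_nonneg e))

end Fit

end Summit.QuantumFields.YangMills.BalabanUVNodes.N15.CurvedSpecies

end
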